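import Mathlib.Algebra.MvPolynomial.PDeriv
import Mathlib.Algebra.MvPolynomial.CommRing
import Mathlib.RingTheory.MvPolynomial.Basic
import Mathlib.Algebra.CharP.Basic
import Mathlib.Algebra.CharP.Lemmas
import Mathlib.Data.Fin.VecNotation
import Mathlib.RingTheory.Ideal.Operations
import Mathlib.Tactic.LinearCombination
import Mathlib.Tactic.NormNum
import Mathlib.Tactic.FinCases
import HarnessLib

/-!
# Kill test K3.1 (LADDER-RESOLUTION rung L, slot W3.1): the specimen `Ê = (y² − x²z² + x⁵, 2)` in characteristic `3` —
# polynomial certificates for its edge data at a general axis point and at the origin (test T3 of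
# `L/res-L1-k31/PREREG-K3.1.md`)

Cell `res-hironaka`, seat `res-L1-k31`; companion of `MarkedTransferCampaignW31InvOrderConvention.lean` (p461082), which settled the
ORDER CONVENTION (test T1). HONEST FRAMING: «[OURS · L1 W3.1] kill-test helper; NOT a statement of the manuscript.» Every
declaration below is an explicit polynomial identity / ideal membership in `K[x, y, z] = MvPolynomial (Fin 3) K` (`x = X 0`,
`y = X 1`, `z = X 2`), an elementary statement about `K`-points, or bookkeeping with the tree's `EdgeAlgebra.Presentation`; NOTHING
here asserts a statement of H. Hironaka's manuscript (2017-03-23, [claim: Hironaka2017, status: under-review]); its definitions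
(geometric `℘`, p.17 l.1–3; Def. 4.9 / 4.11 pp.20–21; Eq. (34) p.24) are quoted for locators only, and the LOGICAL glue from these
certificates to «the edge algebra of `Ê` at `Q` is `K[x̄, ȳ]`, at `O` it is `K[ȳ]`» is the hand argument of
`L/res-L1-k31/KILL-TEST-K3.1.md` §3 (CAS cross-check: kit job j258388), NOT a kernel theorem.

Contents.
* §0 the specimen `f = y² − x²z² + x⁵`, its first partials `fx, fy, fz` (`pderiv_f_*`: they ARE the formal partials), the ideals
  `axisIdeal = (x, y)` (the `z`-axis) and `maxIdealO = (x, y, z)` (the origin), the coordinate changes `shiftQ c` (`z ↦ z + c`, moving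
  the axis point `Q = (0,0,c)` to the origin) and the three affine charts `chartX/Y/Z` of the blow-up of the origin.
* §1 SINGULAR LOCUS: `J = (f, fx, fy, fz) ⊆ (x, y)` and `5·x⁵, 2·y ∈ J` (explicit certificates), hence over any field of
  characteristic `3` the common zeros of `f, fx, fy, fz` in `K³` are exactly the points of the `z`-axis (`singularPoint_iff`) —
  `Sing(Ê) = {ord f ≥ 2} = V(f, ∂f)` is the `z`-axis; `f ∈ (x, y)²`: order `≥ 2 = b` along the whole axis (the axis is a permissible
  centre, §2.1 p.4).
* §2 TANGENT CONES: `shiftQ c f = (y² − c²x²) + tail`, `tail ∈ (x,y,z)³` (initial form at `Q`: the rank-2 quadric `ȳ² − c²x̄²`);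
  `f − y² ∈ (x,y,z)⁴` (initial form at `O`: `ȳ²`); first partials: `fy = 2y`; `shiftQ c fx = −2c²·x + (order ≥ 2)`; `fx, fz ∈ (x,y,z)³`
  (no degree-1 contribution at `O`). These are the inputs of the LOWER bounds `x̄, ȳ ∈ G(Q)₁`, `ȳ ∈ G(O)₁` (via Giraud's lemma /
  the manuscript's Th. 4.1 (2), a CANDIDATE premise — see the report).
* §3 BLOW-UP OF THE ORIGIN: `chartX f = x²·f₁X`, `chartY f = y²·f₁Y`, `chartZ f = z²·f₁Z`; `f₁X ∈ (x, y)²` and `f₁Z ∈ (y, z)²` (the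
  exceptional `ℙ¹ = {Y = 0}` consists of points of order `2` of the transform — each a permissible centre), `f₁Z ∈ (x, y)²` (strict
  transform of the axis), `f₁Y − 1 ∈ (y)` (no singular point of the transform on the exceptional divisor in the `y`-chart).
* §4 THE ESCAPE TEST AT `O` (UPPER bound `G(O) ⊆ K[ȳ]`, structure-theorem form): a candidate extra generator with initial form
  `(αx + γz)^q + βy^q` transforms in the `x`-chart to `x^q·((α + γz′)^q + βy′^q)`, whose value at the exceptional point `(0,0,a)` is
  `(α + γa)^q`; if that vanishes for all `a` then `α = γ = 0` (`eq_zero_of_forall_pow_eq_zero`).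
* (T2, the two edge algebras `K[x̄, ȳ]`, `K[ȳ]` as `EdgeAlgebra.Presentation`s and their typed `Inv` values) is the sibling file
  `MarkedTransferCampaignW31QuinticEdgeAlgebras.lean`.

Host item: MarkedTransfer `HypersurfaceOrderReduction` (stmt-ResolutionOfSingularities-16155), as for p461082 — the specimen is a marked
hypersurface ideal `(𝔸³, (f), ∅, 2)` of its type. No new route, no new item.

## References
* H. Hironaka, ms. 2017-03-23 [Hironaka2017]: §2.1 p.4 (Sing, permissibility), Def. 2.1 p.5 (transform), p.17 l.1–3 (geometric `℘`),
  Th. 4.1 p.17, Rem. 4.7 / Def. 4.9 p.20, Def. 4.11 p.21, Eq. (34) p.24 — locators only.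
* J. Giraud, Ann. Sci. ÉNS 8 (1975) 201–234 (Giraud's lemma; report only). Cell files `L/res-L1-k31/*K3.1.md`; kit job j258388.
-/

set_option linter.dupNamespace false -- mandated namespace of this single-conjunct summit

noncomputable section

namespace Summit.ResolutionOfSingularities.ResolutionOfSingularities.Theorems.QuinticEdgeData

open MvPolynomial

variable {K : Type*} [CommRing K]

/-! ## §0 The specimen and the coordinate changes -/

/-- The specimen `f = y² − x²z² + x⁵ ∈ K[x,y,z]` (`x = X 0`, `y = X 1`, `z = X 2`) of kill test K3.1; `Ê = (f, 2)`.
[OURS · L1 W3.1] kill-test helper; NOT a statement of the manuscript. -/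
def f : MvPolynomial (Fin 3) K := X 1 ^ 2 - X 0 ^ 2 * X 2 ^ 2 + X 0 ^ 5

/-- `fx = ∂f/∂x = −2xz² + 5x⁴`. [OURS · L1 W3.1] kill-test helper; NOT a statement of the manuscript. -/
def fx : MvPolynomial (Fin 3) K := -2 * X 0 * X 2 ^ 2 + 5 * X 0 ^ 4

/-- `fy = ∂f/∂y = 2y`. [OURS · L1 W3.1] kill-test helper; NOT a statement of the manuscript. -/
def fy : MvPolynomial (Fin 3) K := 2 * X 1

/-- `fz = ∂f/∂z = −2x²z`. [OURS · L1 W3.1] kill-test helper; NOT a statement of the manuscript. -/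
def fz : MvPolynomial (Fin 3) K := -2 * X 0 ^ 2 * X 2

/-- The ideal `(x, y)` of the `z`-axis. [OURS · L1 W3.1] kill-test helper; NOT a statement of the manuscript. -/
def axisIdeal : Ideal (MvPolynomial (Fin 3) K) := Ideal.span {X 0, X 1}

/-- The ideal `(x, y, z)` of the origin `O`. [OURS · L1 W3.1] kill-test helper; NOT a statement of the manuscript. -/
def maxIdealO : Ideal (MvPolynomial (Fin 3) K) := Ideal.span {X 0, X 1, X 2}

/-- The translation `z ↦ z + c` (`x, y` fixed) moving the axis point `Q = (0, 0, c)` to the origin.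
[OURS · L1 W3.1] kill-test helper; NOT a statement of the manuscript. -/
def shiftQ (c : K) : MvPolynomial (Fin 3) K →ₐ[K] MvPolynomial (Fin 3) K := aeval ![X 0, X 1, X 2 + C c]

/-- The `x`-chart `(x, y, z) ↦ (x, xy, xz)` of the blow-up of the origin. [OURS · L1 W3.1] kill-test helper; NOT a statement of the
manuscript. -/
def chartX : MvPolynomial (Fin 3) K →ₐ[K] MvPolynomial (Fin 3) K := aeval ![X 0, X 0 * X 1, X 0 * X 2]

/-- The `y`-chart `(x, y, z) ↦ (xy, y, yz)` of the blow-up of the origin. [OURS · L1 W3.1] kill-test helper; NOT a statement of the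
manuscript. -/
def chartY : MvPolynomial (Fin 3) K →ₐ[K] MvPolynomial (Fin 3) K := aeval ![X 0 * X 1, X 1, X 1 * X 2]

/-- The `z`-chart `(x, y, z) ↦ (xz, yz, z)` of the blow-up of the origin. [OURS · L1 W3.1] kill-test helper; NOT a statement of the
manuscript. -/
def chartZ : MvPolynomial (Fin 3) K →ₐ[K] MvPolynomial (Fin 3) K := aeval ![X 0 * X 2, X 1 * X 2, X 2]

/-- Controlled transform of `f` (exponent `b = 2`) in the `x`-chart: `f₁X = y′² − x²z′² + x³`. [OURS · L1 W3.1] kill-test helper;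
NOT a statement of the manuscript. -/
def f₁X : MvPolynomial (Fin 3) K := X 1 ^ 2 - X 0 ^ 2 * X 2 ^ 2 + X 0 ^ 3

/-- Controlled transform of `f` in the `y`-chart: `f₁Y = 1 − x′²y²z′² + x′⁵y³`. [OURS · L1 W3.1] kill-test helper; NOT a statement
of the manuscript. -/
def f₁Y : MvPolynomial (Fin 3) K := 1 - X 0 ^ 2 * X 1 ^ 2 * X 2 ^ 2 + X 0 ^ 5 * X 1 ^ 3

/-- Controlled transform of `f` in the `z`-chart: `f₁Z = y′² − x′²z² + x′⁵z³`. [OURS · L1 W3.1] kill-test helper; NOT a statement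
of the manuscript. -/
def f₁Z : MvPolynomial (Fin 3) K := X 1 ^ 2 - X 0 ^ 2 * X 2 ^ 2 + X 0 ^ 5 * X 2 ^ 3

/-! ### The named partials are the formal partial derivatives -/

/-- `∂f/∂x = fx`. [OURS · L1 W3.1] kill-test helper; NOT a statement of the manuscript. -/
theorem pderiv_f_zero : pderiv 0 (f : MvPolynomial (Fin 3) K) = fx := by
  simp only [f, fx, map_add, map_sub, pderiv_mul, pderiv_pow, pderiv_X_self,
    pderiv_X_of_ne (show (1 : Fin 3) ≠ 0 by decide), pderiv_X_of_ne (show (2 : Fin 3) ≠ 0 by decide)]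
  push_cast
  ring

/-- `∂f/∂y = fy`. [OURS · L1 W3.1] kill-test helper; NOT a statement of the manuscript. -/
theorem pderiv_f_one : pderiv 1 (f : MvPolynomial (Fin 3) K) = fy := by
  simp only [f, fy, map_add, map_sub, pderiv_mul, pderiv_pow, pderiv_X_self,
    pderiv_X_of_ne (show (0 : Fin 3) ≠ 1 by decide), pderiv_X_of_ne (show (2 : Fin 3) ≠ 1 by decide)]
  push_cast
  ring

/-- `∂f/∂z = fz`. [OURS · L1 W3.1] kill-test helper; NOT a statement of the manuscript. -/
theorem pderiv_f_two : pderiv 2 (f : MvPolynomial (Fin 3) K) = fz := by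
  simp only [f, fz, map_add, map_sub, pderiv_mul, pderiv_pow, pderiv_X_self,
    pderiv_X_of_ne (show (0 : Fin 3) ≠ 2 by decide), pderiv_X_of_ne (show (1 : Fin 3) ≠ 2 by decide)]
  push_cast
  ring

/-! ## §1 The singular locus `V(f, fx, fy, fz)` is the `z`-axis; order `≥ 2` along it -/

/-- `x ∈ (x, y)`. [OURS] helper. -/
private theorem X0_mem_axis : (X 0 : MvPolynomial (Fin 3) K) ∈ axisIdeal := Ideal.subset_span (by simp)
/-- `y ∈ (x, y)`. [OURS] helper. -/
private theorem X1_mem_axis : (X 1 : MvPolynomial (Fin 3) K) ∈ axisIdeal := Ideal.subset_span (by simp)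

/-- `f ∈ (x, y)²`: `f` has order `≥ 2 = b` along the whole `z`-axis, i.e. the axis lies in `Sing(Ê)` and is a permissible centre
(§2.1 p.4: a closed smooth irreducible subscheme of `Sing(E)`). Certificate: `f = y·y + x·x·(x³ − z²)`.
[OURS · L1 W3.1] kill-test helper; NOT a statement of the manuscript. -/
theorem f_mem_axisIdeal_sq : (f : MvPolynomial (Fin 3) K) ∈ axisIdeal ^ 2 := by
  have h : (f : MvPolynomial (Fin 3) K) = X 1 * X 1 + X 0 * X 0 * (X 0 ^ 3 - X 2 ^ 2) := by unfold f; ring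
  rw [h, pow_two]
  exact Ideal.add_mem _ (Ideal.mul_mem_mul X1_mem_axis X1_mem_axis)
    (Ideal.mul_mem_right _ _ (Ideal.mul_mem_mul X0_mem_axis X0_mem_axis))

/-- `fx, fy, fz ∈ (x, y)` (and `f ∈ (x, y)`): the ideal `J = (f, fx, fy, fz)` of the singular locus is contained in the ideal of the
`z`-axis. [OURS · L1 W3.1] kill-test helper; NOT a statement of the manuscript. -/
theorem partials_mem_axisIdeal :
    (f : MvPolynomial (Fin 3) K) ∈ axisIdeal ∧ (fx : MvPolynomial (Fin 3) K) ∈ axisIdeal ∧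
      (fy : MvPolynomial (Fin 3) K) ∈ axisIdeal ∧ (fz : MvPolynomial (Fin 3) K) ∈ axisIdeal := by
  refine ⟨?_, ?_, ?_, ?_⟩
  · exact Ideal.pow_le_self two_ne_zero f_mem_axisIdeal_sq
  · have h : (fx : MvPolynomial (Fin 3) K) = X 0 * (-2 * X 2 ^ 2 + 5 * X 0 ^ 3) := by unfold fx; ring
    rw [h]; exact Ideal.mul_mem_right _ _ X0_mem_axis
  · have h : (fy : MvPolynomial (Fin 3) K) = X 1 * 2 := by unfold fy; ring
    rw [h]; exact Ideal.mul_mem_right _ _ X1_mem_axis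
  · have h : (fz : MvPolynomial (Fin 3) K) = X 0 * (-2 * X 0 * X 2) := by unfold fz; ring
    rw [h]; exact Ideal.mul_mem_right _ _ X0_mem_axis

/-- Radical-membership certificates: `x·fx − z·fz = 5·x⁵` and `fy = 2·y`; over a ring where `2` and `5` are units (characteristic `3`)
this puts `x⁵` and `y` in `J = (f, fx, fy, fz)`, so `√J ⊇ (x, y)`. [OURS · L1 W3.1] kill-test helper; NOT a statement of the manuscript. -/
theorem radical_certificates :
    X 0 * (fx : MvPolynomial (Fin 3) K) - X 2 * fz = 5 * X 0 ^ 5 ∧ (fy : MvPolynomial (Fin 3) K) = 2 * X 1 := by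
  constructor
  · unfold fx fz; ring
  · rfl

/-- **`Sing(Ê)` is the `z`-axis, at the level of `K`-points, for any field `K` of characteristic `3`:** a point `(a, b, c) ∈ K³` is a
common zero of `f, fx, fy, fz` (i.e. `ord_{(a,b,c)} f ≥ 2`) iff `a = b = 0`. [OURS · L1 W3.1] kill-test helper; NOT a statement of the
manuscript. -/
theorem singularPoint_iff {K : Type*} [Field K] [CharP K 3] (a b c : K) :
    (eval ![a, b, c] (f : MvPolynomial (Fin 3) K) = 0 ∧ eval ![a, b, c] (fx : MvPolynomial (Fin 3) K) = 0 ∧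
      eval ![a, b, c] (fy : MvPolynomial (Fin 3) K) = 0 ∧ eval ![a, b, c] (fz : MvPolynomial (Fin 3) K) = 0) ↔
    (a = 0 ∧ b = 0) := by
  have h2 : (2 : K) ≠ 0 := by
    intro h
    have h' : ((2 : ℕ) : K) = 0 := by exact_mod_cast h
    have := (CharP.cast_eq_zero_iff K 3 2).1 h'
    omega
  have h5 : (5 : K) ≠ 0 := by
    intro h
    have h' : ((5 : ℕ) : K) = 0 := by exact_mod_cast h
    have := (CharP.cast_eq_zero_iff K 3 5).1 h'
    omega
  simp only [f, fx, fy, fz, map_add, map_sub, map_mul, map_pow, map_neg, eval_X, map_ofNat,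
    Matrix.cons_val_zero, Matrix.cons_val_one, Matrix.cons_val_two, Matrix.tail_cons, Matrix.head_cons]
  constructor
  · rintro ⟨hf, hx, hy, hz⟩
    have hb : b = 0 := by
      rcases mul_eq_zero.1 hy with h | h
      · exact absurd h h2
      · exact h
    have ha5 : (5 : K) * a ^ 5 = 0 := by linear_combination a * hx - c * hz
    have ha : a = 0 := by
      rcases mul_eq_zero.1 ha5 with h | h
      · exact absurd h h5
      · exact pow_eq_zero_iff (by norm_num) |>.1 h
    exact ⟨ha, hb⟩
  · rintro ⟨rfl, rfl⟩
    refine ⟨?_, ?_, ?_, ?_⟩ <;> ring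

/-! ## §2 Tangent cones and the initial forms of the first partials -/

/-- `x ∈ (x, y, z)`. [OURS] helper. -/
private theorem X0_mem_max : (X 0 : MvPolynomial (Fin 3) K) ∈ maxIdealO := Ideal.subset_span (by simp)
/-- `y ∈ (x, y, z)`. [OURS] helper. -/
private theorem X1_mem_max : (X 1 : MvPolynomial (Fin 3) K) ∈ maxIdealO := Ideal.subset_span (by simp)
/-- `z ∈ (x, y, z)`. [OURS] helper. -/
private theorem X2_mem_max : (X 2 : MvPolynomial (Fin 3) K) ∈ maxIdealO := Ideal.subset_span (by simp)

/-- `shiftQ c x = x`. [OURS] helper. -/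
private theorem shiftQ_X0 (c : K) : shiftQ c (X 0 : MvPolynomial (Fin 3) K) = X 0 := by simp [shiftQ]
/-- `shiftQ c y = y`. [OURS] helper. -/
private theorem shiftQ_X1 (c : K) : shiftQ c (X 1 : MvPolynomial (Fin 3) K) = X 1 := by simp [shiftQ]
/-- `shiftQ c z = z + c`. [OURS] helper. -/
private theorem shiftQ_X2 (c : K) : shiftQ c (X 2 : MvPolynomial (Fin 3) K) = X 2 + C c := by simp [shiftQ]

/-- **Tangent cone at the axis point `Q = (0,0,c)`**: after `z ↦ z + c`,
`f = (y² − c²x²) + (−2c·x²z − x²z² + x⁵)`; the second summand has order `≥ 3` (`shiftQ_f_tail_mem`), so the initial form of `f` at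
`Q` is the quadric `ȳ² − c²x̄²`, of rank `2` when `c ≠ 0` (two transversal smooth branches through the axis).
[OURS · L1 W3.1] kill-test helper; NOT a statement of the manuscript. -/
theorem shiftQ_f (c : K) : shiftQ c (f : MvPolynomial (Fin 3) K) =
    (X 1 ^ 2 - C (c ^ 2) * X 0 ^ 2) + (-(C (2 * c)) * X 0 ^ 2 * X 2 - X 0 ^ 2 * X 2 ^ 2 + X 0 ^ 5) := by
  simp only [f, map_add, map_sub, map_mul, map_pow, shiftQ_X0, shiftQ_X1, shiftQ_X2, map_mul C, map_pow C, map_ofNat C]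
  ring

/-- The tail `−2c·x²z − x²z² + x⁵` of `shiftQ_f` lies in `(x, y, z)³`. [OURS · L1 W3.1] kill-test helper; NOT a statement of the
manuscript. -/
theorem shiftQ_f_tail_mem (c : K) :
    (-(C (2 * c)) * X 0 ^ 2 * X 2 - X 0 ^ 2 * X 2 ^ 2 + X 0 ^ 5 : MvPolynomial (Fin 3) K) ∈ maxIdealO ^ 3 := by
  have h3 : (X 0 ^ 2 * X 2 : MvPolynomial (Fin 3) K) ∈ maxIdealO ^ 3 := by
    rw [pow_succ]; exact Ideal.mul_mem_mul (Ideal.pow_mem_pow X0_mem_max 2) X2_mem_max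
  have h4 : (X 0 ^ 5 : MvPolynomial (Fin 3) K) ∈ maxIdealO ^ 3 :=
    Ideal.pow_le_pow_right (by norm_num) (Ideal.pow_mem_pow X0_mem_max 5)
  have e : (-(C (2 * c)) * X 0 ^ 2 * X 2 - X 0 ^ 2 * X 2 ^ 2 + X 0 ^ 5 : MvPolynomial (Fin 3) K) =
      (-(C (2 * c)) - X 2) * (X 0 ^ 2 * X 2) + X 0 ^ 5 := by ring
  rw [e]
  exact Ideal.add_mem _ (Ideal.mul_mem_left _ _ h3) h4

/-- **Tangent cone at the origin**: `f − y² = −x²z² + x⁵ ∈ (x, y, z)⁴`, so the initial form of `f` at `O` is `ȳ²` (rank `1`).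
[OURS · L1 W3.1] kill-test helper; NOT a statement of the manuscript. -/
theorem f_sub_Ysq_mem : (f - X 1 ^ 2 : MvPolynomial (Fin 3) K) ∈ maxIdealO ^ 4 := by
  have h22 : (X 0 ^ 2 * X 2 ^ 2 : MvPolynomial (Fin 3) K) ∈ maxIdealO ^ 4 := by
    rw [show (4 : ℕ) = 2 + 2 by norm_num, pow_add]
    exact Ideal.mul_mem_mul (Ideal.pow_mem_pow X0_mem_max 2) (Ideal.pow_mem_pow X2_mem_max 2)
  have h5 : (X 0 ^ 5 : MvPolynomial (Fin 3) K) ∈ maxIdealO ^ 4 :=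
    Ideal.pow_le_pow_right (by norm_num) (Ideal.pow_mem_pow X0_mem_max 5)
  have e : (f - X 1 ^ 2 : MvPolynomial (Fin 3) K) = -(X 0 ^ 2 * X 2 ^ 2) + X 0 ^ 5 := by unfold f; ring
  rw [e]
  exact Ideal.add_mem _ (neg_mem h22) h5

/-- **First partial `fx` at `Q`**: `shiftQ c fx = −2c²·x + (−4c·xz − 2xz² + 5x⁴)`, the bracket in `(x, y, z)²`; so `fx` has order `1` at
`Q` with initial form `−2c²·x̄`, a unit multiple of `x̄` when `c ≠ 0` (with `fy = 2y`: the inputs for `x̄, ȳ ∈ G(Q)₁`).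
[OURS · L1 W3.1] kill-test helper; NOT a statement of the manuscript. -/
theorem shiftQ_fx (c : K) : shiftQ c (fx : MvPolynomial (Fin 3) K) =
    -(C (2 * c ^ 2)) * X 0 + (-(C (4 * c)) * X 0 * X 2 - 2 * X 0 * X 2 ^ 2 + 5 * X 0 ^ 4) ∧
    (-(C (4 * c)) * X 0 * X 2 - 2 * X 0 * X 2 ^ 2 + 5 * X 0 ^ 4 : MvPolynomial (Fin 3) K) ∈ maxIdealO ^ 2 := by
  constructor
  · simp only [fx, map_add, map_mul, map_pow, map_neg, shiftQ_X0, shiftQ_X2, map_ofNat, map_mul C, map_pow C]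
    ring
  · have h2 : (X 0 * X 2 : MvPolynomial (Fin 3) K) ∈ maxIdealO ^ 2 := by
      rw [pow_two]; exact Ideal.mul_mem_mul X0_mem_max X2_mem_max
    have h4 : (X 0 ^ 4 : MvPolynomial (Fin 3) K) ∈ maxIdealO ^ 2 :=
      Ideal.pow_le_pow_right (by norm_num) (Ideal.pow_mem_pow X0_mem_max 4)
    have e : (-(C (4 * c)) * X 0 * X 2 - 2 * X 0 * X 2 ^ 2 + 5 * X 0 ^ 4 : MvPolynomial (Fin 3) K) =
        (-(C (4 * c)) - 2 * X 2) * (X 0 * X 2) + 5 * X 0 ^ 4 := by ring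
    rw [e]
    exact Ideal.add_mem _ (Ideal.mul_mem_left _ _ h2) (Ideal.mul_mem_left _ _ h4)

/-- **First partials at the origin**: `fx, fz ∈ (x, y, z)³` — they contribute nothing in degree `1` or `2` at `O`; only `fy = 2y`
does (input for `ȳ ∈ G(O)₁`). [OURS · L1 W3.1] kill-test helper; NOT a statement of the manuscript. -/
theorem fx_fz_mem_cube : (fx : MvPolynomial (Fin 3) K) ∈ maxIdealO ^ 3 ∧ (fz : MvPolynomial (Fin 3) K) ∈ maxIdealO ^ 3 := by
  have h12 : (X 0 * X 2 ^ 2 : MvPolynomial (Fin 3) K) ∈ maxIdealO ^ 3 := by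
    rw [pow_succ']
    exact Ideal.mul_mem_mul X0_mem_max (Ideal.pow_mem_pow X2_mem_max 2)
  have h21 : (X 0 ^ 2 * X 2 : MvPolynomial (Fin 3) K) ∈ maxIdealO ^ 3 := by
    rw [pow_succ]; exact Ideal.mul_mem_mul (Ideal.pow_mem_pow X0_mem_max 2) X2_mem_max
  have h4 : (X 0 ^ 4 : MvPolynomial (Fin 3) K) ∈ maxIdealO ^ 3 :=
    Ideal.pow_le_pow_right (by norm_num) (Ideal.pow_mem_pow X0_mem_max 4)
  constructor
  · have e : (fx : MvPolynomial (Fin 3) K) = -2 * (X 0 * X 2 ^ 2) + 5 * X 0 ^ 4 := by unfold fx; ring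
    rw [e]; exact Ideal.add_mem _ (Ideal.mul_mem_left _ _ h12) (Ideal.mul_mem_left _ _ h4)
  · have e : (fz : MvPolynomial (Fin 3) K) = -2 * (X 0 ^ 2 * X 2) := by unfold fz; ring
    rw [e]; exact Ideal.mul_mem_left _ _ h21

/-! ## §3 The blow-up of the origin: charts, controlled transforms, singular points on the exceptional divisor -/

/-- `chartX` on variables. [OURS] helper. -/
private theorem chartX_X (i : Fin 3) :
    chartX (X i : MvPolynomial (Fin 3) K) = ![X 0, X 0 * X 1, X 0 * X 2] i := by simp [chartX]
/-- `chartX` on constants. [OURS] helper. -/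
private theorem chartX_C (a : K) : chartX (C a : MvPolynomial (Fin 3) K) = C a := by simp [chartX]
/-- `chartY` on variables. [OURS] helper. -/
private theorem chartY_X (i : Fin 3) :
    chartY (X i : MvPolynomial (Fin 3) K) = ![X 0 * X 1, X 1, X 1 * X 2] i := by simp [chartY]
/-- `chartZ` on variables. [OURS] helper. -/
private theorem chartZ_X (i : Fin 3) :
    chartZ (X i : MvPolynomial (Fin 3) K) = ![X 0 * X 2, X 1 * X 2, X 2] i := by simp [chartZ]

/-- `x`-chart: total transform `f(x, xy′, xz′) = x²·f₁X` (exceptional divisor `x = 0`, exponent `b = 2`).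
[OURS · L1 W3.1] kill-test helper; NOT a statement of the manuscript. -/
theorem chartX_f : chartX (f : MvPolynomial (Fin 3) K) = X 0 ^ 2 * f₁X := by
  simp only [f, f₁X, map_add, map_sub, map_mul, map_pow, chartX_X, Matrix.cons_val_zero, Matrix.cons_val_one,
    Matrix.cons_val_two, Matrix.tail_cons, Matrix.head_cons]
  ring

/-- `y`-chart: `f(x′y, y, yz′) = y²·f₁Y`. [OURS · L1 W3.1] kill-test helper; NOT a statement of the manuscript. -/
theorem chartY_f : chartY (f : MvPolynomial (Fin 3) K) = X 1 ^ 2 * f₁Y := by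
  simp only [f, f₁Y, map_add, map_sub, map_mul, map_pow, chartY_X, Matrix.cons_val_zero, Matrix.cons_val_one,
    Matrix.cons_val_two, Matrix.tail_cons, Matrix.head_cons]
  ring

/-- `z`-chart: `f(x′z, y′z, z) = z²·f₁Z`. [OURS · L1 W3.1] kill-test helper; NOT a statement of the manuscript. -/
theorem chartZ_f : chartZ (f : MvPolynomial (Fin 3) K) = X 2 ^ 2 * f₁Z := by
  simp only [f, f₁Z, map_add, map_sub, map_mul, map_pow, chartZ_X, Matrix.cons_val_zero, Matrix.cons_val_one,
    Matrix.cons_val_two, Matrix.tail_cons, Matrix.head_cons]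
  ring

/-- In the `x`-chart the controlled transform has order `≥ 2` along the exceptional line `{x = y′ = 0}`: `f₁X ∈ (x, y′)²`
(certificate `f₁X = y′·y′ + x·x·(x − z′²)`). Every closed point `(0, 0, a)` of that line is in `Sing` of the transform, hence a
permissible centre for it. [OURS · L1 W3.1] kill-test helper; NOT a statement of the manuscript. -/
theorem f₁X_mem_sq : (f₁X : MvPolynomial (Fin 3) K) ∈ axisIdeal ^ 2 := by
  have h : (f₁X : MvPolynomial (Fin 3) K) = X 1 * X 1 + X 0 * X 0 * (X 0 - X 2 ^ 2) := by unfold f₁X; ring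
  rw [h, pow_two]
  exact Ideal.add_mem _ (Ideal.mul_mem_mul X1_mem_axis X1_mem_axis)
    (Ideal.mul_mem_right _ _ (Ideal.mul_mem_mul X0_mem_axis X0_mem_axis))

/-- In the `z`-chart: `f₁Z ∈ (x′, y′)²` (the strict transform of the axis stays in `Sing`) and `f₁Z ∈ (y′, z)²` (the line
`{y′ = z = 0}` of the exceptional divisor — the other affine piece of the exceptional `ℙ¹ = {Y = 0}` — is in `Sing`).
[OURS · L1 W3.1] kill-test helper; NOT a statement of the manuscript. -/
theorem f₁Z_mem_sq : (f₁Z : MvPolynomial (Fin 3) K) ∈ (Ideal.span {X 0, X 1}) ^ 2 ∧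
    (f₁Z : MvPolynomial (Fin 3) K) ∈ (Ideal.span {X 1, X 2}) ^ 2 := by
  have hx : (X 0 : MvPolynomial (Fin 3) K) ∈ Ideal.span {X 0, X 1} := Ideal.subset_span (by simp)
  have hy : (X 1 : MvPolynomial (Fin 3) K) ∈ Ideal.span {X 0, X 1} := Ideal.subset_span (by simp)
  have hy' : (X 1 : MvPolynomial (Fin 3) K) ∈ Ideal.span {X 1, X 2} := Ideal.subset_span (by simp)
  have hz' : (X 2 : MvPolynomial (Fin 3) K) ∈ Ideal.span {X 1, X 2} := Ideal.subset_span (by simp)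
  constructor
  · have h : (f₁Z : MvPolynomial (Fin 3) K) = X 1 * X 1 + X 0 * X 0 * (X 0 ^ 3 * X 2 ^ 3 - X 2 ^ 2) := by unfold f₁Z; ring
    rw [h, pow_two]
    exact Ideal.add_mem _ (Ideal.mul_mem_mul hy hy) (Ideal.mul_mem_right _ _ (Ideal.mul_mem_mul hx hx))
  · have h : (f₁Z : MvPolynomial (Fin 3) K) = X 1 * X 1 + X 2 * X 2 * (X 0 ^ 5 * X 2 - X 0 ^ 2) := by unfold f₁Z; ring
    rw [h, pow_two]
    exact Ideal.add_mem _ (Ideal.mul_mem_mul hy' hy') (Ideal.mul_mem_right _ _ (Ideal.mul_mem_mul hz' hz'))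

/-- In the `y`-chart the transform is a unit along the exceptional divisor `{y = 0}`: `f₁Y − 1 ∈ (y)` — no singular (indeed no)
point of the transform there. [OURS · L1 W3.1] kill-test helper; NOT a statement of the manuscript. -/
theorem f₁Y_sub_one_mem : (f₁Y - 1 : MvPolynomial (Fin 3) K) ∈ Ideal.span {(X 1 : MvPolynomial (Fin 3) K)} := by
  have h : (f₁Y - 1 : MvPolynomial (Fin 3) K) = X 1 * (X 1 * (-(X 0 ^ 2 * X 2 ^ 2) + X 0 ^ 5 * X 1)) := by unfold f₁Y; ring
  rw [h]
  exact Ideal.mul_mem_right _ _ (Ideal.subset_span (by simp))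

/-! ## §4 The escape test at the origin (upper bound `G(O) ⊆ K[ȳ]`, structure-theorem form) -/

/-- A candidate additional generator of the edge algebra at `O` with initial form `(αx + γz)^q + βy^q` transforms in the `x`-chart to
`x^q · ((α + γz′)^q + βy′^q)` — its controlled transform (exponent `q`) restricted to the exceptional divisor is
`(α + γz′)^q + βy′^q`. [OURS · L1 W3.1] kill-test helper; NOT a statement of the manuscript. -/
theorem chartX_candidate (α β γ : K) (q : ℕ) :
    chartX ((C α * X 0 + C γ * X 2) ^ q + C β * X 1 ^ q : MvPolynomial (Fin 3) K) =
      X 0 ^ q * ((C α + C γ * X 2) ^ q + C β * X 1 ^ q) := by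
  simp only [map_add, map_mul, map_pow, chartX_X, chartX_C, Matrix.cons_val_zero, Matrix.cons_val_one,
    Matrix.cons_val_two, Matrix.tail_cons, Matrix.head_cons]
  rw [show (C α * X 0 + C γ * (X 0 * X 2) : MvPolynomial (Fin 3) K) = X 0 * (C α + C γ * X 2) by ring, mul_pow,
    mul_pow]
  ring

/-- Its value at the exceptional point `(0, 0, a)` is `(α + γa)^q` (`q ≥ 1`). Permissibility of that point (a point of `Sing` of the
transform of `Ê`, §3) for the candidate's transform requires order `≥ q ≥ 1` there, in particular this value must vanish.
[OURS · L1 W3.1] kill-test helper; NOT a statement of the manuscript. -/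
theorem eval_candidate_exceptionalPoint (α β γ a : K) {q : ℕ} (hq : 0 < q) :
    eval ![0, 0, a] ((C α + C γ * X 2) ^ q + C β * X 1 ^ q : MvPolynomial (Fin 3) K) = (α + γ * a) ^ q := by
  simp only [map_add, map_mul, map_pow, eval_C, eval_X, Matrix.cons_val_zero, Matrix.cons_val_one, Matrix.cons_val_two,
    Matrix.tail_cons, Matrix.head_cons, zero_pow hq.ne', mul_zero, add_zero]

/-- If `(α + γt)^q = 0` for every `t` in a reduced nontrivial ring (e.g. a field), `q ≥ 1`, then `α = γ = 0` (test `t = 0`, `t = 1`):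
no candidate with `(α, γ) ≠ (0, 0)` survives — the edge algebra at `O` has no generator outside `K[ȳ]`.
[OURS · L1 W3.1] kill-test helper; NOT a statement of the manuscript. -/
theorem eq_zero_of_forall_pow_eq_zero {K : Type*} [CommRing K] [IsReduced K] (α γ : K) {q : ℕ} (hq : 0 < q)
    (h : ∀ t : K, (α + γ * t) ^ q = 0) : α = 0 ∧ γ = 0 := by
  have hα : α = 0 := by simpa using pow_eq_zero_iff hq.ne' |>.1 (by simpa using h 0)
  refine ⟨hα, ?_⟩
  have h1 := h 1
  rw [hα, zero_add, mul_one] at h1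
  exact pow_eq_zero_iff hq.ne' |>.1 h1


end Summit.ResolutionOfSingularities.ResolutionOfSingularities.Theorems.QuinticEdgeData

end
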